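import Summits.NavierStokesRegularity.NavierStokesRegularity.Theorems.EfficiencyFloorRigidExitLateExit
import Literature.Analysis.FluidPDE.ClassicalNSFiniteEnergyEquality
import Literature.Analysis.FluidPDE.BKMClassGradientContinuity
import HarnessLib

/-!
# Route `EfficiencyFloor`, support `RigidExit` (stmt-25513) on the `ProductionEfficiencyDecay` ladder (stmt-22866):
# ENERGY × ENSTROPHY ON A MAXIMISER INTERVAL — orbit selection replaced by a scalar RESONANCE condition

Helper file (`--supports stmt-NavierStokesRegularity-22866 --as helper`; line `efficiency_floor`). The landed reading of `RigidExit`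
(`…RigidExitSaturationExit`) asks for a NON-MAXIMISER INSTANT in every short window `[s, s + ηW(s))` of the flow («instant exit»;
item (i) ORBIT SELECTION: a classical trajectory of normalised maximisers would be a C¹ path in one symmetry orbit, contradicting
part (b)). `…RigidExitLateExit` (p835741) settled this at LATE times by Seregin's criterion. This file treats ALL times by pure
scalar bookkeeping — Leray's energy equality + the saturated cubic law — with no Lie-group selection:

* `energy_enstrophy_affine` (§2, BY NAME, sharp constant `c⋆`): if all slices `u(σ)`, `σ ∈ [s,s₁] ⊂ (0,T)`, of a maximal classical
  Leray–Hopf rapidly-decaying-datum solution are normalised maximisers, then the cubic law is SATURATED there, `Z` is strictly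
  increasing, `∫ₛ^σ Z = (Z(s)⁻¹ − Z(σ)⁻¹)/K` (`K = 27c⋆⁴/(128ν³)`), and by the energy equality `E(σ) = E(s) − 2ν∫ₛ^σ Z`
  (`E = ∫|u|²`, tree `IsClassicalNSSolutionOn.energyEq_finiteEnergy`, `∫|∇u|²_F = ∫|curl u|²`):
  `E(σ)·Z(σ) = (E(s)·Z(s) − R)·(Z(σ)/Z(s)) + R`, `R = 2ν/K = 256ν⁴/(27c⋆⁴)` —
  the scale-invariant product `E·Z` is an AFFINE function of the amplification ratio along a maximiser interval.
* `resonance_of_maximiserInterval` (§3): if `E(m)·Z(m)` takes only FINITELY many values on the normalised-maximiser set (true under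
  clause (a) of `MaximiserSetRigidity`: `E·Z` is invariant under translations, linear isometries and the scaling `m ↦ l•m(l•·)`, so
  its values are those of the finitely many representatives — proved in the sequel `…RigidExitResonanceOrbit`), then a maximiser
  interval forces the RESONANCE `E(s)·Z(s) = R`.
* `exists_nonMaximiser_instant_of_nonresonant` (§4): hence, if moreover NO normalised maximiser is resonant (`E(m)·Z(m) ≠ R`, a
  condition on the finitely many representatives), EVERY interval `[s,s₁] ⊂ (0,T)` contains a non-maximiser instant — item (i) of the
  READING in full, at all times, for every solution of the route's class.
* `earlyDeficit_everywhere_of_nonresonant` (§5, BY NAME): feeding `RigidExit.earlyDeficit_pos_of_nonMaximiser_instant`: under the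
  finite-value + non-resonance hypothesis, at EVERY slice time `s ∈ (0,T)` with `s + ηW(s) < T` the early-deficit inequality
  `(1 − η + 2θ)·Z(u s)⁻² ≤ Z(u(s + ηW(s)))⁻²` holds with some `θ = θ(u,s) > 0`. What then remains of `RigidExit` is ONLY the
  uniformity of `θ` (continuous dependence in `Ḣ¹∩Ḣ²`, READING item (ii)) — plus the resonant case `E·Z = 256ν⁴/(27c⋆⁴)` on some
  maximiser orbit, where the PDE Liouville argument (`ProfileLiouville.no_movingOrbit_solution`) is still needed.

Interpolation places the resonance: `Z² ≤ E·Pal` and the normalisation `Pal = (81c⋆⁴/(256ν⁴))Z³` give `E·Z ≥ R/3` on every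
normalised maximiser, so `R` is NOT excluded a priori. HONEST FRAMING: statements about a HYPOTHETICAL blow-up; `RigidExit`,
clause (a), `NearMaximiserBoundedAmplification`, `LerayFloorGap`, `ProductionEfficiencyDecay` (stmt-22866) and Navier–Stokes
regularity stay OPEN; no summit statement is proved. [folklore]
-/

-- the problem directory repeats the summit name (`NavierStokesRegularity/NavierStokesRegularity`)
set_option linter.dupNamespace false

noncomputable section

open Set Filter MeasureTheory Topology Function
open scoped InnerProductSpace RealInnerProductSpace ENNReal NNReal
open Literature.Analysis.FluidPDE

namespace Summit.NavierStokesRegularity.NavierStokesRegularity.Theorems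

namespace RigidExit

namespace Resonance

open NearMaximiserBoundedAmplification

/-! ## §1 Real analysis: the dissipation over a saturated interval -/

/-- **FTC under saturation.** If `Z > 0` on `[s,t]` with `Z' = K·Z³` there (`K ≠ 0`), then
`∫ₛᵗ Z = K⁻¹·(Z(s)⁻¹ − Z(t)⁻¹)` (`(Z⁻¹)' = −K·Z`). [folklore] -/
theorem intervalIntegral_eq_of_saturation {Zr : ℝ → ℝ} {K s t : ℝ} (hK : K ≠ 0) (hst : s ≤ t)
    (hpos : ∀ τ ∈ Icc s t, 0 < Zr τ) (hder : ∀ τ ∈ Icc s t, HasDerivAt Zr (K * Zr τ ^ 3) τ) :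
    ∫ τ in s..t, Zr τ = K⁻¹ * ((Zr s)⁻¹ - (Zr t)⁻¹) := by
  have hF : ∀ τ ∈ uIcc s t, HasDerivAt (fun σ => -K⁻¹ * (Zr σ)⁻¹) (Zr τ) τ := by
    intro τ hτ
    rw [uIcc_of_le hst] at hτ
    have hZ := hpos τ hτ
    have h1 := ((hasDerivAt_inv hZ.ne').comp τ (hder τ hτ)).const_mul (-K⁻¹)
    refine h1.congr_deriv ?_
    field_simp
  have hcont : ContinuousOn Zr (uIcc s t) := fun τ hτ => by
    rw [uIcc_of_le hst] at hτ
    exact (hder τ hτ).continuousAt.continuousWithinAt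
  rw [intervalIntegral.integral_eq_sub_of_hasDerivAt hF hcont.intervalIntegrable]
  ring

/-- **Lower-integral dissipation as an interval integral.** If on `[s,t]` the slice dissipation `∫⁻ |∇u(τ)|²_F` equals
`ofReal (Z(τ))` with `Z ≥ 0` continuous, then `(∫⁻_{(s,t)} ∫⁻ |∇u|²_F).toReal = ∫ₛᵗ Z`. [folklore] -/
theorem toReal_dissipation_eq_intervalIntegral {u : ℝ → EuclideanSpace ℝ (Fin 3) → EuclideanSpace ℝ (Fin 3)}
    {Zr : ℝ → ℝ} {s t : ℝ} (hst : s ≤ t)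
    (hslice : ∀ τ ∈ Icc s t, ∫⁻ x, ENNReal.ofReal (frobeniusNormSq (fderiv ℝ (u τ) x)) = ENNReal.ofReal (Zr τ))
    (hnn : ∀ τ ∈ Icc s t, 0 ≤ Zr τ) (hcont : ContinuousOn Zr (Icc s t)) :
    (∫⁻ τ in Ioo s t, ∫⁻ x, ENNReal.ofReal (frobeniusNormSq (fderiv ℝ (u τ) x))).toReal = ∫ τ in s..t, Zr τ := by
  have h1 : ∫⁻ τ in Ioo s t, ∫⁻ x, ENNReal.ofReal (frobeniusNormSq (fderiv ℝ (u τ) x)) =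
      ∫⁻ τ in Ioo s t, ENNReal.ofReal (Zr τ) := by
    refine setLIntegral_congr_fun measurableSet_Ioo ?_
    intro τ hτ
    exact hslice τ (Ioo_subset_Icc_self hτ)
  have hint : IntegrableOn Zr (Ioo s t) := (hcont.integrableOn_compact isCompact_Icc).mono_set Ioo_subset_Icc_self
  have hnn' : 0 ≤ᵐ[volume.restrict (Ioo s t)] Zr :=
    (ae_restrict_iff' measurableSet_Ioo).2 (Eventually.of_forall fun τ hτ => hnn τ (Ioo_subset_Icc_self hτ))
  rw [h1, ← ofReal_integral_eq_lintegral_ofReal hint hnn', ENNReal.toReal_ofReal (setIntegral_nonneg measurableSet_Ioo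
    fun τ hτ => hnn τ (Ioo_subset_Icc_self hτ)), intervalIntegral.integral_of_le hst, integral_Ioc_eq_integral_Ioo]


/-! ## §2 BY NAME: `E·Z` is affine in the amplification ratio along a maximiser interval -/

/-- **Energy × enstrophy on a maximiser interval.** For the sharp constant `c⋆`: along every maximal classical Leray–Hopf
rapidly-decaying-datum solution, if all slices `u(σ)`, `σ ∈ [s,s₁]` (`0 < s < s₁ < T`), are normalised maximisers, then for every
`σ ∈ [s,s₁]`: `Z(u s) ≤ Z(u σ)` with `<` for `σ > s`, and
`E(σ)·Z(σ) = (E(s)·Z(s) − 256ν⁴/(27c⋆⁴))·(Z(σ)/Z(s)) + 256ν⁴/(27c⋆⁴)` with `E(σ) = ∫|u(σ)|²`, `Z(σ) = ∫|curl u(σ)|²`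
(energy equality + saturated cubic law). [cite: Leray1934, §17 (3.4) p. 220] -/
theorem energy_enstrophy_affine :
    ∃ c : ℝ, (0 < c ∧ (∀ v : EuclideanSpace ℝ (Fin 3) → EuclideanSpace ℝ (Fin 3), (ContDiff ℝ (⊤ : ℕ∞) v ∧
      VectorCalculus.IsDivFree v ∧ (∫⁻ x, ‖iteratedFDeriv ℝ 0 v x‖ₑ ^ 2 < ⊤) ∧ (∫⁻ x, ‖iteratedFDeriv ℝ 1 v x‖ₑ ^ 2 < ⊤) ∧
      (∫⁻ x, ‖iteratedFDeriv ℝ 2 v x‖ₑ ^ 2 < ⊤)) → (∫ x, ⟪curl v x, fderiv ℝ v x (curl v x)⟫_ℝ) ≤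
      c * (∫ x, ‖curl v x‖ ^ 2) ^ (3 / 4 : ℝ) * (∫ x, frobeniusNormSq (fderiv ℝ (curl v) x)) ^ (3 / 4 : ℝ)) ∧
      ∀ c' : ℝ, (∀ w : EuclideanSpace ℝ (Fin 3) → EuclideanSpace ℝ (Fin 3), (ContDiff ℝ (⊤ : ℕ∞) w ∧
      VectorCalculus.IsDivFree w ∧ (∫⁻ x, ‖iteratedFDeriv ℝ 0 w x‖ₑ ^ 2 < ⊤) ∧ (∫⁻ x, ‖iteratedFDeriv ℝ 1 w x‖ₑ ^ 2 < ⊤) ∧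
      (∫⁻ x, ‖iteratedFDeriv ℝ 2 w x‖ₑ ^ 2 < ⊤)) → (∫ x, ⟪curl w x, fderiv ℝ w x (curl w x)⟫_ℝ) ≤
      c' * (∫ x, ‖curl w x‖ ^ 2) ^ (3 / 4 : ℝ) * (∫ x, frobeniusNormSq (fderiv ℝ (curl w) x)) ^ (3 / 4 : ℝ)) → c ≤ c') ∧
      ∀ (ν T : ℝ), 0 < ν → 0 < T →
      ∀ (u : ℝ → EuclideanSpace ℝ (Fin 3) → EuclideanSpace ℝ (Fin 3)) (p : ℝ → EuclideanSpace ℝ (Fin 3) → ℝ),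
      IsMaximalSmoothSolution ν 0 u p T → IsLerayHopfOn T ν 0 (u 0) u → HasRapidSpatialDecay (u 0) →
      ∀ s s₁ : ℝ, 0 < s → s < s₁ → s₁ < T → (∀ σ ∈ Icc s s₁, ((ContDiff ℝ (⊤ : ℕ∞) (u σ) ∧ VectorCalculus.IsDivFree (u σ) ∧
        (∫⁻ x, ‖iteratedFDeriv ℝ 0 (u σ) x‖ₑ ^ 2 < ⊤) ∧ (∫⁻ x, ‖iteratedFDeriv ℝ 1 (u σ) x‖ₑ ^ 2 < ⊤) ∧
        (∫⁻ x, ‖iteratedFDeriv ℝ 2 (u σ) x‖ₑ ^ 2 < ⊤)) ∧ 0 < (∫ x, ‖curl (u σ) x‖ ^ 2) ∧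
        (∫ x, ⟪curl (u σ) x, fderiv ℝ (u σ) x (curl (u σ) x)⟫_ℝ) = c * (∫ x, ‖curl (u σ) x‖ ^ 2) ^ (3 / 4 : ℝ) *
          (∫ x, frobeniusNormSq (fderiv ℝ (curl (u σ)) x)) ^ (3 / 4 : ℝ) ∧
        (∫ x, frobeniusNormSq (fderiv ℝ (curl (u σ)) x)) = 81 * c ^ 4 / (256 * ν ^ 4) * (∫ x, ‖curl (u σ) x‖ ^ 2) ^ 3)) →
      ∀ σ ∈ Icc s s₁, ((s < σ → (∫ x, ‖curl (u s) x‖ ^ 2) < (∫ x, ‖curl (u σ) x‖ ^ 2)) ∧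
        (∫ x, ‖u σ x‖ ^ 2) * (∫ x, ‖curl (u σ) x‖ ^ 2) =
          ((∫ x, ‖u s x‖ ^ 2) * (∫ x, ‖curl (u s) x‖ ^ 2) - 256 * ν ^ 4 / (27 * c ^ 4)) *
            ((∫ x, ‖curl (u σ) x‖ ^ 2) / (∫ x, ‖curl (u s) x‖ ^ 2)) + 256 * ν ^ 4 / (27 * c ^ 4)) := by
  obtain ⟨c, hsharp, hbud⟩ := exists_budget_saturated_iff_normalisedMaximiser
  refine ⟨c, hsharp, fun ν T hν hT u p hmax hLH hdec s s₁ hs0 hss₁ hs₁T hNM σ hσ => ?_⟩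
  obtain ⟨Zr, D, hZD, hsat⟩ := hbud ν T hν hT u p hmax hLH hdec
  have hc : 0 < c := hsharp.1
  set K : ℝ := 27 * c ^ 4 / (128 * ν ^ 3) with hK
  have hKpos : 0 < K := by positivity
  have hR : 256 * ν ^ 4 / (27 * c ^ 4) = 2 * ν / K := by rw [hK]; field_simp; ring
  have hIoo : ∀ τ ∈ Icc s s₁, τ ∈ Ioo 0 T := fun τ hτ => ⟨hs0.trans_le hτ.1, hτ.2.trans_lt hs₁T⟩
  -- the budget dictionary on `[s,s₁]`
  have hZeq : ∀ τ ∈ Icc s s₁, Zr τ = ∫ x, ‖curl (u τ) x‖ ^ 2 := fun τ hτ => (hZD τ (hIoo τ hτ)).2.2.2.1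
  have hpos : ∀ τ ∈ Icc s s₁, 0 < Zr τ := fun τ hτ => by
    have h1 := lintegral_curl_sq_pos hν hT hmax hLH hdec τ ⟨(hIoo τ hτ).1.le, (hIoo τ hτ).2⟩
    rw [(hZD τ (hIoo τ hτ)).1] at h1
    exact ENNReal.ofReal_pos.1 h1
  -- saturation: `Z' = K Z³` on `[s,s₁]`
  have hder : ∀ τ ∈ Icc s s₁, HasDerivAt Zr (K * Zr τ ^ 3) τ := fun τ hτ => by
    have h := (hZD τ (hIoo τ hτ)).2.2.2.2.1
    have hD : D τ = K * Zr τ ^ 3 := by rw [hK]; exact (hsat τ (hIoo τ hτ)).2 (hNM τ hτ)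
    rwa [hD] at h
  -- slice dissipation `∫⁻ |∇u(τ)|²_F = ofReal (Z τ)`
  have hslice : ∀ τ ∈ Icc s s₁, ∫⁻ x, ENNReal.ofReal (frobeniusNormSq (fderiv ℝ (u τ) x)) = ENNReal.ofReal (Zr τ) := by
    intro τ hτ
    obtain ⟨hlin, -, ⟨hsm, hdiv, h0, h1, h2⟩, -⟩ := hZD τ (hIoo τ hτ)
    have h0' : ∫⁻ x, ‖u τ x‖ₑ ^ 2 < ⊤ := by
      refine lt_of_le_of_lt (le_of_eq (lintegral_congr fun x => ?_)) h0
      rw [← ofReal_norm, ← norm_iteratedFDeriv_zero (𝕜 := ℝ) (f := u τ), ofReal_norm]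
    rw [lintegral_frobeniusNormSq_fderiv_eq_lintegral_curl_sq (hsm.of_le (by norm_cast)) hdiv h0' h1 h2, hlin]
  -- energy equality on `[s, σ] ⊆ [0, s₁]`
  have hcl : IsClassicalNSSolutionOn (Icc 0 s₁) ν 0 u p :=
    hmax.isClassicalNSSolutionOn.mono (Icc_subset_Ico_right hs₁T) (uniqueDiffOn_Icc (hs0.trans hss₁))
  have hfe : ∃ A : ℝ≥0∞, A < ⊤ ∧ ∀ t ∈ Icc 0 s₁, ∫⁻ x, ‖u t x‖ₑ ^ 2 ≤ A :=
    ⟨ENNReal.ofReal (2 * VectorCalculus.kineticEnergy (u 0)), ENNReal.ofReal_lt_top, fun t ht =>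
      hLH.lintegral_enorm_sq_le hν.le ⟨ht.1, ht.2.trans hs₁T.le⟩⟩
  have hE := hcl.energyEq_finiteEnergy hν (hs0.trans hss₁) hfe hs0.le hσ.1 hσ.2
  -- the dissipation on `[s, σ]` is `K⁻¹ (Z(s)⁻¹ − Z(σ)⁻¹)`
  have hsub : Icc s σ ⊆ Icc s s₁ := Icc_subset_Icc_right hσ.2
  have hcontZ : ContinuousOn Zr (Icc s σ) := fun τ hτ => (hder τ (hsub hτ)).continuousAt.continuousWithinAt
  have hdiss : (∫⁻ τ in Ioo s σ, ∫⁻ x, ENNReal.ofReal (frobeniusNormSq (fderiv ℝ (u τ) x))).toReal =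
      K⁻¹ * ((Zr s)⁻¹ - (Zr σ)⁻¹) := by
    rw [toReal_dissipation_eq_intervalIntegral hσ.1 (fun τ hτ => hslice τ (hsub hτ))
      (fun τ hτ => (hpos τ (hsub hτ)).le) hcontZ]
    exact intervalIntegral_eq_of_saturation hKpos.ne' hσ.1 (fun τ hτ => hpos τ (hsub hτ)) fun τ hτ => hder τ (hsub hτ)
  rw [hdiss] at hE
  simp only [VectorCalculus.kineticEnergy] at hE
  -- monotonicity of `Z` on `[s, σ]`
  have hZs : 0 < Zr s := hpos s ⟨le_rfl, hss₁.le⟩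
  have hZσ : 0 < Zr σ := hpos σ hσ
  have hmono : s < σ → Zr s < Zr σ := fun hsσ => by
    have hK' : ∀ τ ∈ Icc s σ, HasDerivAt Zr (K * Zr τ ^ 3) τ := fun τ hτ => hder τ (hsub hτ)
    have hcont' : ContinuousOn Zr (Icc s σ) := hcontZ
    have hpos' : ∀ τ ∈ interior (Icc s σ), 0 < deriv Zr τ := fun τ hτ => by
      rw [interior_Icc] at hτ
      rw [(hK' τ (Ioo_subset_Icc_self hτ)).deriv]
      exact mul_pos hKpos (pow_pos (hpos τ (hsub (Ioo_subset_Icc_self hτ))) 3)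
    exact (strictMonoOn_of_deriv_pos (convex_Icc s σ) hcont' hpos') ⟨le_rfl, hsσ.le⟩ ⟨hsσ.le, le_rfl⟩ hsσ
  rw [← hZeq s ⟨le_rfl, hss₁.le⟩, ← hZeq σ hσ]
  refine ⟨hmono, ?_⟩
  rw [hR]
  -- algebra: `E(σ) = E(s) − (2ν/K)(Z(s)⁻¹ − Z(σ)⁻¹)`
  have hEσ : ∫ x, ‖u σ x‖ ^ 2 = (∫ x, ‖u s x‖ ^ 2) - 2 * ν * (K⁻¹ * ((Zr s)⁻¹ - (Zr σ)⁻¹)) := by linarith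
  rw [hEσ]
  field_simp
  ring


/-! ## §3 Finitely many values of `E·Z` on the maximiser set ⟹ a maximiser interval is RESONANT -/

/-- **Resonance.** For the sharp constant `c⋆`: if the scale-invariant product `E(m)·Z(m) = (∫|m|²)(∫|curl m|²)` takes only
finitely many values on the normalised-maximiser set (true under clause (a) of `MaximiserSetRigidity`), then along every maximal
classical Leray–Hopf rapidly-decaying-datum solution, a maximiser interval `[s,s₁] ⊂ (0,T)` forces `E(s)·Z(s) = 256ν⁴/(27c⋆⁴)`
(an affine function with non-zero slope of the strictly increasing `Z` would take infinitely many values). [folklore] -/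
theorem resonance_of_maximiserInterval :
    ∃ c : ℝ, (0 < c ∧ (∀ v : EuclideanSpace ℝ (Fin 3) → EuclideanSpace ℝ (Fin 3), (ContDiff ℝ (⊤ : ℕ∞) v ∧
      VectorCalculus.IsDivFree v ∧ (∫⁻ x, ‖iteratedFDeriv ℝ 0 v x‖ₑ ^ 2 < ⊤) ∧ (∫⁻ x, ‖iteratedFDeriv ℝ 1 v x‖ₑ ^ 2 < ⊤) ∧
      (∫⁻ x, ‖iteratedFDeriv ℝ 2 v x‖ₑ ^ 2 < ⊤)) → (∫ x, ⟪curl v x, fderiv ℝ v x (curl v x)⟫_ℝ) ≤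
      c * (∫ x, ‖curl v x‖ ^ 2) ^ (3 / 4 : ℝ) * (∫ x, frobeniusNormSq (fderiv ℝ (curl v) x)) ^ (3 / 4 : ℝ)) ∧
      ∀ c' : ℝ, (∀ w : EuclideanSpace ℝ (Fin 3) → EuclideanSpace ℝ (Fin 3), (ContDiff ℝ (⊤ : ℕ∞) w ∧
      VectorCalculus.IsDivFree w ∧ (∫⁻ x, ‖iteratedFDeriv ℝ 0 w x‖ₑ ^ 2 < ⊤) ∧ (∫⁻ x, ‖iteratedFDeriv ℝ 1 w x‖ₑ ^ 2 < ⊤) ∧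
      (∫⁻ x, ‖iteratedFDeriv ℝ 2 w x‖ₑ ^ 2 < ⊤)) → (∫ x, ⟪curl w x, fderiv ℝ w x (curl w x)⟫_ℝ) ≤
      c' * (∫ x, ‖curl w x‖ ^ 2) ^ (3 / 4 : ℝ) * (∫ x, frobeniusNormSq (fderiv ℝ (curl w) x)) ^ (3 / 4 : ℝ)) → c ≤ c') ∧
      ∀ (ν T : ℝ), 0 < ν → 0 < T →
      ∀ (u : ℝ → EuclideanSpace ℝ (Fin 3) → EuclideanSpace ℝ (Fin 3)) (p : ℝ → EuclideanSpace ℝ (Fin 3) → ℝ),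
      IsMaximalSmoothSolution ν 0 u p T → IsLerayHopfOn T ν 0 (u 0) u → HasRapidSpatialDecay (u 0) →
      ∀ S : Finset ℝ, (∀ m : EuclideanSpace ℝ (Fin 3) → EuclideanSpace ℝ (Fin 3), ((ContDiff ℝ (⊤ : ℕ∞) m ∧ VectorCalculus.IsDivFree m ∧
        (∫⁻ x, ‖iteratedFDeriv ℝ 0 m x‖ₑ ^ 2 < ⊤) ∧ (∫⁻ x, ‖iteratedFDeriv ℝ 1 m x‖ₑ ^ 2 < ⊤) ∧
        (∫⁻ x, ‖iteratedFDeriv ℝ 2 m x‖ₑ ^ 2 < ⊤)) ∧ 0 < (∫ x, ‖curl m x‖ ^ 2) ∧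
        (∫ x, ⟪curl m x, fderiv ℝ m x (curl m x)⟫_ℝ) = c * (∫ x, ‖curl m x‖ ^ 2) ^ (3 / 4 : ℝ) *
          (∫ x, frobeniusNormSq (fderiv ℝ (curl m) x)) ^ (3 / 4 : ℝ) ∧
        (∫ x, frobeniusNormSq (fderiv ℝ (curl m) x)) = 81 * c ^ 4 / (256 * ν ^ 4) * (∫ x, ‖curl m x‖ ^ 2) ^ 3) →
        (∫ x, ‖m x‖ ^ 2) * (∫ x, ‖curl m x‖ ^ 2) ∈ S) →
      ∀ s s₁ : ℝ, 0 < s → s < s₁ → s₁ < T → (∀ σ ∈ Icc s s₁, ((ContDiff ℝ (⊤ : ℕ∞) (u σ) ∧ VectorCalculus.IsDivFree (u σ) ∧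
        (∫⁻ x, ‖iteratedFDeriv ℝ 0 (u σ) x‖ₑ ^ 2 < ⊤) ∧ (∫⁻ x, ‖iteratedFDeriv ℝ 1 (u σ) x‖ₑ ^ 2 < ⊤) ∧
        (∫⁻ x, ‖iteratedFDeriv ℝ 2 (u σ) x‖ₑ ^ 2 < ⊤)) ∧ 0 < (∫ x, ‖curl (u σ) x‖ ^ 2) ∧
        (∫ x, ⟪curl (u σ) x, fderiv ℝ (u σ) x (curl (u σ) x)⟫_ℝ) = c * (∫ x, ‖curl (u σ) x‖ ^ 2) ^ (3 / 4 : ℝ) *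
          (∫ x, frobeniusNormSq (fderiv ℝ (curl (u σ)) x)) ^ (3 / 4 : ℝ) ∧
        (∫ x, frobeniusNormSq (fderiv ℝ (curl (u σ)) x)) = 81 * c ^ 4 / (256 * ν ^ 4) * (∫ x, ‖curl (u σ) x‖ ^ 2) ^ 3)) →
      (∫ x, ‖u s x‖ ^ 2) * (∫ x, ‖curl (u s) x‖ ^ 2) = 256 * ν ^ 4 / (27 * c ^ 4) := by
  obtain ⟨c, hsharp, haff⟩ := energy_enstrophy_affine
  refine ⟨c, hsharp, fun ν T hν hT u p hmax hLH hdec S hS s s₁ hs0 hss₁ hs₁T hNM => ?_⟩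
  by_contra hne
  set R : ℝ := 256 * ν ^ 4 / (27 * c ^ 4) with hRdef
  set κ : ℝ := (∫ x, ‖u s x‖ ^ 2) * (∫ x, ‖curl (u s) x‖ ^ 2) with hκ
  set Z : ℝ → ℝ := fun σ => ∫ x, ‖curl (u σ) x‖ ^ 2 with hZ
  set f : ℝ → ℝ := fun σ => (∫ x, ‖u σ x‖ ^ 2) * Z σ with hf
  have hA := haff ν T hν hT u p hmax hLH hdec
  -- `Z` is strictly increasing on `[s,s₁]` (apply §2 from every base point)
  have hZmono : StrictMonoOn Z (Icc s s₁) := by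
    intro a ha b hb hab
    have hNM' : ∀ σ ∈ Icc a s₁, _ := fun σ hσ => hNM σ ⟨ha.1.trans hσ.1, hσ.2⟩
    exact ((hA a s₁ (hs0.trans_le ha.1) (hab.trans_le hb.2) hs₁T hNM' b ⟨hab.le, hb.2⟩).1 hab)
  have hZs : 0 < Z s := (hNM s ⟨le_rfl, hss₁.le⟩).2.1
  -- `f = (κ − R)·(Z/Z(s)) + R` on `[s,s₁]`, with values in `S`
  have hfaff : ∀ σ ∈ Icc s s₁, f σ = (κ - R) * (Z σ / Z s) + R := fun σ hσ =>
    (hA s s₁ hs0 hss₁ hs₁T hNM σ hσ).2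
  have hfS : ∀ σ ∈ Icc s s₁, f σ ∈ (S : Set ℝ) := fun σ hσ => hS (u σ) (hNM σ hσ)
  -- `f` is injective on `[s,s₁]` since `κ ≠ R`
  have hκR : κ - R ≠ 0 := sub_ne_zero.2 hne
  have hfinj : InjOn f (Icc s s₁) := by
    intro a ha b hb hab
    rw [hfaff a ha, hfaff b hb] at hab
    have h1 : Z a / Z s = Z b / Z s := by
      have := add_right_cancel hab
      exact mul_left_cancel₀ hκR this
    have h2 : Z a = Z b := by
      field_simp at h1
      exact h1
    exact hZmono.injOn ha hb h2
  have hinf : (f '' Icc s s₁).Infinite := ((Ioo_infinite hss₁).mono Ioo_subset_Icc_self).image hfinj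
  exact hinf (S.finite_toSet.subset (image_subset_iff.2 fun σ hσ => hfS σ hσ))

/-! ## §4 Non-resonance ⟹ every interval carries a non-maximiser instant (orbit selection, all times) -/

/-- **Early exit off resonance.** If `E·Z` takes finitely many values on the normalised maximisers, none equal to `256ν⁴/(27c⋆⁴)`,
then along every solution of the route's class EVERY interval `[s,s₁] ⊂ (0,T)` contains an instant whose slice is NOT a normalised
maximiser (route clause verbatim). [folklore] -/
theorem exists_nonMaximiser_instant_of_nonresonant :
    ∃ c : ℝ, (0 < c ∧ (∀ v : EuclideanSpace ℝ (Fin 3) → EuclideanSpace ℝ (Fin 3), (ContDiff ℝ (⊤ : ℕ∞) v ∧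
      VectorCalculus.IsDivFree v ∧ (∫⁻ x, ‖iteratedFDeriv ℝ 0 v x‖ₑ ^ 2 < ⊤) ∧ (∫⁻ x, ‖iteratedFDeriv ℝ 1 v x‖ₑ ^ 2 < ⊤) ∧
      (∫⁻ x, ‖iteratedFDeriv ℝ 2 v x‖ₑ ^ 2 < ⊤)) → (∫ x, ⟪curl v x, fderiv ℝ v x (curl v x)⟫_ℝ) ≤
      c * (∫ x, ‖curl v x‖ ^ 2) ^ (3 / 4 : ℝ) * (∫ x, frobeniusNormSq (fderiv ℝ (curl v) x)) ^ (3 / 4 : ℝ)) ∧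
      ∀ c' : ℝ, (∀ w : EuclideanSpace ℝ (Fin 3) → EuclideanSpace ℝ (Fin 3), (ContDiff ℝ (⊤ : ℕ∞) w ∧
      VectorCalculus.IsDivFree w ∧ (∫⁻ x, ‖iteratedFDeriv ℝ 0 w x‖ₑ ^ 2 < ⊤) ∧ (∫⁻ x, ‖iteratedFDeriv ℝ 1 w x‖ₑ ^ 2 < ⊤) ∧
      (∫⁻ x, ‖iteratedFDeriv ℝ 2 w x‖ₑ ^ 2 < ⊤)) → (∫ x, ⟪curl w x, fderiv ℝ w x (curl w x)⟫_ℝ) ≤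
      c' * (∫ x, ‖curl w x‖ ^ 2) ^ (3 / 4 : ℝ) * (∫ x, frobeniusNormSq (fderiv ℝ (curl w) x)) ^ (3 / 4 : ℝ)) → c ≤ c') ∧
      ∀ (ν T : ℝ), 0 < ν → 0 < T →
      ∀ (u : ℝ → EuclideanSpace ℝ (Fin 3) → EuclideanSpace ℝ (Fin 3)) (p : ℝ → EuclideanSpace ℝ (Fin 3) → ℝ),
      IsMaximalSmoothSolution ν 0 u p T → IsLerayHopfOn T ν 0 (u 0) u → HasRapidSpatialDecay (u 0) →
      ∀ S : Finset ℝ, (∀ m : EuclideanSpace ℝ (Fin 3) → EuclideanSpace ℝ (Fin 3), ((ContDiff ℝ (⊤ : ℕ∞) m ∧ VectorCalculus.IsDivFree m ∧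
        (∫⁻ x, ‖iteratedFDeriv ℝ 0 m x‖ₑ ^ 2 < ⊤) ∧ (∫⁻ x, ‖iteratedFDeriv ℝ 1 m x‖ₑ ^ 2 < ⊤) ∧
        (∫⁻ x, ‖iteratedFDeriv ℝ 2 m x‖ₑ ^ 2 < ⊤)) ∧ 0 < (∫ x, ‖curl m x‖ ^ 2) ∧
        (∫ x, ⟪curl m x, fderiv ℝ m x (curl m x)⟫_ℝ) = c * (∫ x, ‖curl m x‖ ^ 2) ^ (3 / 4 : ℝ) *
          (∫ x, frobeniusNormSq (fderiv ℝ (curl m) x)) ^ (3 / 4 : ℝ) ∧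
        (∫ x, frobeniusNormSq (fderiv ℝ (curl m) x)) = 81 * c ^ 4 / (256 * ν ^ 4) * (∫ x, ‖curl m x‖ ^ 2) ^ 3) →
        (∫ x, ‖m x‖ ^ 2) * (∫ x, ‖curl m x‖ ^ 2) ∈ S) →
      256 * ν ^ 4 / (27 * c ^ 4) ∉ S →
      ∀ s s₁ : ℝ, 0 < s → s < s₁ → s₁ < T → ∃ σ ∈ Icc s s₁, ¬ ((ContDiff ℝ (⊤ : ℕ∞) (u σ) ∧ VectorCalculus.IsDivFree (u σ) ∧
        (∫⁻ x, ‖iteratedFDeriv ℝ 0 (u σ) x‖ₑ ^ 2 < ⊤) ∧ (∫⁻ x, ‖iteratedFDeriv ℝ 1 (u σ) x‖ₑ ^ 2 < ⊤) ∧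
        (∫⁻ x, ‖iteratedFDeriv ℝ 2 (u σ) x‖ₑ ^ 2 < ⊤)) ∧ 0 < (∫ x, ‖curl (u σ) x‖ ^ 2) ∧
        (∫ x, ⟪curl (u σ) x, fderiv ℝ (u σ) x (curl (u σ) x)⟫_ℝ) = c * (∫ x, ‖curl (u σ) x‖ ^ 2) ^ (3 / 4 : ℝ) *
          (∫ x, frobeniusNormSq (fderiv ℝ (curl (u σ)) x)) ^ (3 / 4 : ℝ) ∧
        (∫ x, frobeniusNormSq (fderiv ℝ (curl (u σ)) x)) = 81 * c ^ 4 / (256 * ν ^ 4) * (∫ x, ‖curl (u σ) x‖ ^ 2) ^ 3) := by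
  obtain ⟨c, hsharp, hres⟩ := resonance_of_maximiserInterval
  refine ⟨c, hsharp, fun ν T hν hT u p hmax hLH hdec S hS hR s s₁ hs0 hss₁ hs₁T => ?_⟩
  by_contra hall
  push Not at hall
  have h := hres ν T hν hT u p hmax hLH hdec S hS s s₁ hs0 hss₁ hs₁T hall
  exact hR (h ▸ hS (u s) (hall s ⟨le_rfl, hss₁.le⟩))

/-! ## §5 BY NAME: the early-deficit inequality at EVERY slice time, off resonance -/

/-- **Early deficit everywhere, off resonance (for one solution, some margin).** For the sharp constant `c⋆` and every `0 < η < 1`: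
if `E·Z` takes finitely many values on the normalised maximisers, none equal to `256ν⁴/(27c⋆⁴)`, then along every maximal classical
Leray–Hopf rapidly-decaying-datum solution, at EVERY slice time `s ∈ (0,T)` with `s' = s + η·W(s) < T`
(`W(s) = (64ν³/(27c⋆⁴))·Z(u s)⁻²`) the early-deficit inequality `(1 − η + 2θ)·Z(u s)⁻² ≤ Z(u s')⁻²` holds with SOME `θ > 0`
(`earlyDeficit_pos_of_nonMaximiser_instant` fed by §4 on `[s, s + η·W(s)/2]`). Uniformity of `θ` is NOT claimed. [folklore] -/
theorem earlyDeficit_everywhere_of_nonresonant :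
    ∃ c : ℝ, (0 < c ∧ (∀ v : EuclideanSpace ℝ (Fin 3) → EuclideanSpace ℝ (Fin 3), (ContDiff ℝ (⊤ : ℕ∞) v ∧
      VectorCalculus.IsDivFree v ∧ (∫⁻ x, ‖iteratedFDeriv ℝ 0 v x‖ₑ ^ 2 < ⊤) ∧ (∫⁻ x, ‖iteratedFDeriv ℝ 1 v x‖ₑ ^ 2 < ⊤) ∧
      (∫⁻ x, ‖iteratedFDeriv ℝ 2 v x‖ₑ ^ 2 < ⊤)) → (∫ x, ⟪curl v x, fderiv ℝ v x (curl v x)⟫_ℝ) ≤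
      c * (∫ x, ‖curl v x‖ ^ 2) ^ (3 / 4 : ℝ) * (∫ x, frobeniusNormSq (fderiv ℝ (curl v) x)) ^ (3 / 4 : ℝ)) ∧
      ∀ c' : ℝ, (∀ w : EuclideanSpace ℝ (Fin 3) → EuclideanSpace ℝ (Fin 3), (ContDiff ℝ (⊤ : ℕ∞) w ∧
      VectorCalculus.IsDivFree w ∧ (∫⁻ x, ‖iteratedFDeriv ℝ 0 w x‖ₑ ^ 2 < ⊤) ∧ (∫⁻ x, ‖iteratedFDeriv ℝ 1 w x‖ₑ ^ 2 < ⊤) ∧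
      (∫⁻ x, ‖iteratedFDeriv ℝ 2 w x‖ₑ ^ 2 < ⊤)) → (∫ x, ⟪curl w x, fderiv ℝ w x (curl w x)⟫_ℝ) ≤
      c' * (∫ x, ‖curl w x‖ ^ 2) ^ (3 / 4 : ℝ) * (∫ x, frobeniusNormSq (fderiv ℝ (curl w) x)) ^ (3 / 4 : ℝ)) → c ≤ c') ∧
      ∀ η : ℝ, 0 < η → η < 1 → ∀ (ν T : ℝ), 0 < ν → 0 < T →
      ∀ (u : ℝ → EuclideanSpace ℝ (Fin 3) → EuclideanSpace ℝ (Fin 3)) (p : ℝ → EuclideanSpace ℝ (Fin 3) → ℝ),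
      IsMaximalSmoothSolution ν 0 u p T → IsLerayHopfOn T ν 0 (u 0) u → HasRapidSpatialDecay (u 0) →
      ∀ S : Finset ℝ, (∀ m : EuclideanSpace ℝ (Fin 3) → EuclideanSpace ℝ (Fin 3), ((ContDiff ℝ (⊤ : ℕ∞) m ∧ VectorCalculus.IsDivFree m ∧
        (∫⁻ x, ‖iteratedFDeriv ℝ 0 m x‖ₑ ^ 2 < ⊤) ∧ (∫⁻ x, ‖iteratedFDeriv ℝ 1 m x‖ₑ ^ 2 < ⊤) ∧
        (∫⁻ x, ‖iteratedFDeriv ℝ 2 m x‖ₑ ^ 2 < ⊤)) ∧ 0 < (∫ x, ‖curl m x‖ ^ 2) ∧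
        (∫ x, ⟪curl m x, fderiv ℝ m x (curl m x)⟫_ℝ) = c * (∫ x, ‖curl m x‖ ^ 2) ^ (3 / 4 : ℝ) *
          (∫ x, frobeniusNormSq (fderiv ℝ (curl m) x)) ^ (3 / 4 : ℝ) ∧
        (∫ x, frobeniusNormSq (fderiv ℝ (curl m) x)) = 81 * c ^ 4 / (256 * ν ^ 4) * (∫ x, ‖curl m x‖ ^ 2) ^ 3) →
        (∫ x, ‖m x‖ ^ 2) * (∫ x, ‖curl m x‖ ^ 2) ∈ S) →
      256 * ν ^ 4 / (27 * c ^ 4) ∉ S →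
      ∀ s ∈ Ioo 0 T, s + η * (64 * ν ^ 3 / (27 * c ^ 4) * (∫ x, ‖curl (u s) x‖ ^ 2)⁻¹ ^ 2) < T →
        ∃ θ : ℝ, 0 < θ ∧ (1 - η + 2 * θ) * (∫ x, ‖curl (u s) x‖ ^ 2)⁻¹ ^ 2 ≤
          (∫ x, ‖curl (u (s + η * (64 * ν ^ 3 / (27 * c ^ 4) * (∫ x, ‖curl (u s) x‖ ^ 2)⁻¹ ^ 2))) x‖ ^ 2)⁻¹ ^ 2 := by
  obtain ⟨c, hsharp, hED⟩ := earlyDeficit_pos_of_nonMaximiser_instant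
  obtain ⟨c₄, hsharp₄, h4⟩ := exists_nonMaximiser_instant_of_nonresonant
  have hc₄ : c₄ = c := sharp_const_unique hsharp₄ hsharp
  subst hc₄
  obtain ⟨c₁, -, hbud⟩ := exists_budget_saturated_iff_normalisedMaximiser
  refine ⟨c₄, hsharp₄, fun η hη0 hη1 ν T hν hT u p hmax hLH hdec S hS hR s hs hs'T => ?_⟩
  have hc : 0 < c₄ := hsharp₄.1
  -- `Z(u s) > 0`, so the window is non-degenerate
  obtain ⟨Zr, D, hZD, -⟩ := hbud ν T hν hT u p hmax hLH hdec
  have hZpos : 0 < ∫ x, ‖curl (u s) x‖ ^ 2 := by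
    have h1 := lintegral_curl_sq_pos hν hT hmax hLH hdec s ⟨hs.1.le, hs.2⟩
    rw [(hZD s hs).1] at h1
    rw [← (hZD s hs).2.2.2.1]
    exact ENNReal.ofReal_pos.1 h1
  set W : ℝ := η * (64 * ν ^ 3 / (27 * c₄ ^ 4) * (∫ x, ‖curl (u s) x‖ ^ 2)⁻¹ ^ 2) with hW
  have hWpos : 0 < W := mul_pos hη0 (mul_pos (by positivity) (pow_pos (inv_pos.2 hZpos) 2))
  -- a non-maximiser instant in `[s, s + W/2] ⊆ [s, s + W)`
  obtain ⟨σ, hσ, hnot⟩ := h4 ν T hν hT u p hmax hLH hdec S hS hR s (s + W / 2) hs.1 (by linarith) (by linarith)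
  exact hED η hη0 hη1 ν T hν hT u p hmax hLH hdec s hs hs'T σ ⟨hσ.1, by linarith [hσ.2]⟩ hnot


end Resonance

end RigidExit

end Summit.NavierStokesRegularity.NavierStokesRegularity.Theorems

end
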